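import Mathlib
import HarnessLib
import Literature.MathematicalPhysics.QuantumManyBody.DyadicCoherentFractionLimit
import Summits.AtomisticToContinuum.BoseEinsteinCondensation.Theses.BECHeatBathGap

/-!
# Crux `ParticleTensorisation` (stmt-AtomisticToContinuum-14367) — strategist r1 census artefact:
# the crux forces an `N`-uniform bound on ALL linear statistics (bounded structure factor,
# sub-Poissonian number fluctuations) of some near-minimiser at every slack

Companion to `STRATEGY-CENSUS-r1.md` (heading `## Negation`). The crux A1 of route `BECHeatBathGap`
is an approximate-tensorisation (heat-bath Poincaré) clause quantified over ALL bounded measurable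
test amplitudes `F` and ALL coordinate-free predictors `g i`. Specialising to

* `F X = (∑ i, φ (X i)) · Θ X` (a linear statistic times the witness) and
* `g i X = ∑ j ≠ i, φ (X j)` (which does not depend on `X i`),

the clause reads `F - g i · Θ = φ (X i) · Θ`, so the crux yields, with the SAME `N`-uniform
constant `C` and for EVERY bounded measurable one-body test function `φ : Space → ℂ`,

  `∃ c, ∫_{Λ^N} |(∑ i φ(x_i) - c) Θ|² ≤ C · ∑ i ∫_{Λ^N} |φ(x_i)|² |Θ|²`,

i.e. `Var_{|Θ|²}(∑ i φ(x_i)) ≤ C · E_{|Θ|²} ∑ i |φ(x_i)|²` (`UniformLinearStatisticBound`): the static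
structure factor of the witness is `≤ C` at every wave-vector (`φ = e^{iq·x}`), and the particle
number in every measurable region `A` is sub-Poissonian up to the factor `C` (`φ = 1_A`,
`UniformSubPoissonianCounts`: `Var N_A ≤ C · E N_A`), uniformly in `N`, in `ρ < ρ₀` and in the
slack `δ`. By `Theorems.ATClause.clause_of_tendsto` / `particleTensorisation_witness_limits`
(p155713) the same bounds pass to every `L²`-cluster point of the witnesses, i.e. to Dirichlet
ground states. No such `N`-uniform fluctuation bound is known for the interacting dilute Bose gas
in the thermodynamic limit (absence of crystalline order / of macroscopic density fluctuations in
the ground state is open there); this is the typed sense in which the crux is a thermodynamic-limit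
STRUCTURAL theorem on `Ψ₀` of the same tier as the summit, recorded for the tribunal. Tools /
consequences only; the crux is neither restated nor weakened. [folklore]
-/

noncomputable section

namespace Summit.AtomisticToContinuum.BoseEinsteinCondensation.Cruxes.ParticleTensorisation.CensusR1

open MeasureTheory Function Finset Set Filter
open scoped ENNReal Topology
open Literature.MathematicalPhysics.QuantumManyBody.BoseGas

/-- The linear statistic `∑ i φ(x_i)` of a configuration. [folklore] -/
def linStat {N : ℕ} (φ : Space → ℂ) (X : Config N) : ℂ := ∑ i : Fin N, φ (X i)

/-- **Uniform linear-statistic (structure-factor) bound for some near-minimiser at every slack.**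
For every admissible `v` there are `ρ₀, C > 0` such that for `0 < ρ < ρ₀`, eventually in `N`, at
every slack `δ > 0` SOME `δ`-near-minimiser `Θ` satisfies, for every bounded measurable
`φ : Space → ℂ`, `∃ c, ∫_{Λ^N} |(∑ i φ(x_i) - c)·Θ|² ≤ C ∑ i ∫_{Λ^N} |φ(x_i)·Θ|²`
(variance of every linear statistic at most `C` times its "Poissonian" size). [folklore] -/
def UniformLinearStatisticBound : Prop :=
  ∀ v : ℝ → ℝ≥0∞, IsRepulsiveFiniteRange v → ∃ ρ₀ : ℝ, 0 < ρ₀ ∧ ∃ C : ℝ, 0 < C ∧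
    ∀ ρ : ℝ, 0 < ρ → ρ < ρ₀ → ∀ᶠ N : ℕ in atTop, ∀ δ : ℝ≥0∞, 0 < δ →
      ∃ Θ : TrialState N (sideLength ρ (N + 1)),
        energy v Θ ≤ groundStateEnergy v N (sideLength ρ (N + 1)) + δ ∧
        ∀ φ : Space → ℂ, Measurable φ → (∃ B : ℝ, ∀ x, ‖φ x‖ ≤ B) →
          ∃ c : ℂ, (∫⁻ X in boxN N (sideLength ρ (N + 1)),
              (‖(linStat φ X - c) * Θ.ψ X‖₊ : ℝ≥0∞) ^ 2) ≤
            ENNReal.ofReal C * ∑ i : Fin N, ∫⁻ X in boxN N (sideLength ρ (N + 1)),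
              (‖φ (X i) * Θ.ψ X‖₊ : ℝ≥0∞) ^ 2

/-- **Uniform sub-Poissonian number fluctuations for some near-minimiser at every slack.**
The special case `φ = 1_A`: for every measurable region `A ⊆ Space`,
`∃ c, ∫_{Λ^N} |(N_A - c)·Θ|² ≤ C · ∑ i ∫_{Λ^N} 1_A(x_i) |Θ|² = C · E_{|Θ|²} N_A`, where
`N_A(X) = #{i : x_i ∈ A}`; in particular `Var_{|Θ|²} N_A ≤ C · E N_A`, uniformly in `N`, `ρ < ρ₀`
and `δ`. [folklore] -/
def UniformSubPoissonianCounts : Prop :=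
  ∀ v : ℝ → ℝ≥0∞, IsRepulsiveFiniteRange v → ∃ ρ₀ : ℝ, 0 < ρ₀ ∧ ∃ C : ℝ, 0 < C ∧
    ∀ ρ : ℝ, 0 < ρ → ρ < ρ₀ → ∀ᶠ N : ℕ in atTop, ∀ δ : ℝ≥0∞, 0 < δ →
      ∃ Θ : TrialState N (sideLength ρ (N + 1)),
        energy v Θ ≤ groundStateEnergy v N (sideLength ρ (N + 1)) + δ ∧
        ∀ A : Set Space, MeasurableSet A →
          ∃ c : ℂ, (∫⁻ X in boxN N (sideLength ρ (N + 1)),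
              (‖(linStat (A.indicator fun _ => (1 : ℂ)) X - c) * Θ.ψ X‖₊ : ℝ≥0∞) ^ 2) ≤
            ENNReal.ofReal C * ∑ i : Fin N, ∫⁻ X in boxN N (sideLength ρ (N + 1)),
              (‖(A.indicator fun _ => (1 : ℂ)) (X i) * Θ.ψ X‖₊ : ℝ≥0∞) ^ 2

/-- Test amplitude `F = (∑ i φ(x_i)) · Θ`. [folklore] -/
def Ftest {N : ℕ} (φ : Space → ℂ) (Θψ : Config N → ℂ) (X : Config N) : ℂ :=
  linStat φ X * Θψ X

/-- Coordinate-free predictor `g i = ∑ j ≠ i, φ(x_j)`. [folklore] -/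
def gtest {N : ℕ} (φ : Space → ℂ) (i : Fin N) (X : Config N) : ℂ :=
  ∑ j ∈ univ.erase i, φ (X j)

/-- A sum of at most `N` values of a `B`-bounded function has norm `≤ N |B|`. [folklore] -/
theorem norm_sum_apply_le {N : ℕ} {φ : Space → ℂ} {B : ℝ} (hB : ∀ x, ‖φ x‖ ≤ B)
    (s : Finset (Fin N)) (X : Config N) : ‖∑ j ∈ s, φ (X j)‖ ≤ N * |B| := by
  calc ‖∑ j ∈ s, φ (X j)‖ ≤ ∑ j ∈ s, ‖φ (X j)‖ := norm_sum_le _ _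
    _ ≤ ∑ _j ∈ s, |B| := Finset.sum_le_sum fun j _ => (hB _).trans (le_abs_self B)
    _ = s.card * |B| := by rw [Finset.sum_const, nsmul_eq_mul]
    _ ≤ N * |B| := by
        gcongr
        calc s.card ≤ (univ : Finset (Fin N)).card := Finset.card_le_card (Finset.subset_univ s)
          _ = N := by simp

/-- The predictor `g i` does not depend on the `i`-th coordinate. [folklore] -/
theorem gtest_update {N : ℕ} (φ : Space → ℂ) (i : Fin N) (X : Config N) (x : Space) :
    gtest φ i (Function.update X i x) = gtest φ i X := by
  unfold gtest
  refine Finset.sum_congr rfl fun j hj => ?_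
  rw [Function.update_of_ne (Finset.ne_of_mem_erase hj)]

/-- The residual of the test data is the one-particle term: `F - g i · Θ = φ(x_i) · Θ`. [folklore] -/
theorem Ftest_sub_gtest {N : ℕ} (φ : Space → ℂ) (Θψ : Config N → ℂ) (i : Fin N) (X : Config N) :
    Ftest φ Θψ X - gtest φ i X * Θψ X = φ (X i) * Θψ X := by
  simp only [Ftest, gtest, linStat]
  rw [← Finset.add_sum_erase univ (fun j => φ (X j)) (mem_univ i)]
  ring

/-- **The crux forces the uniform linear-statistic bound** (specialise the AT clause to
`F = (∑ φ(x_i))·Θ`, `g i = ∑_{j ≠ i} φ(x_j)`). [folklore] -/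
theorem uniformLinearStatisticBound_of_particleTensorisation
    (h : Summit.AtomisticToContinuum.BoseEinsteinCondensation.Theses.BECHeatBathGap.ParticleTensorisation) :
    UniformLinearStatisticBound := by
  intro v hv
  obtain ⟨ρ₀, hρ₀, C, hC, H⟩ := h v hv
  refine ⟨ρ₀, hρ₀, C, hC, fun ρ hρ hρlt => ?_⟩
  filter_upwards [H ρ hρ hρlt] with N hN
  intro δ hδ
  obtain ⟨Θ, hΘE, hAT⟩ := hN δ hδ
  refine ⟨Θ, hΘE, fun φ hφ hφb => ?_⟩
  obtain ⟨B, hB⟩ := hφb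
  obtain ⟨M, hM⟩ := Θ.contDiff.continuous.bounded_above_of_compact_support Θ.hasCompactSupport
  have hΘm : Measurable Θ.ψ := Θ.contDiff.continuous.measurable
  have hlin : Measurable (fun X : Config N => linStat φ X) := by
    show Measurable fun X : Config N => ∑ i : Fin N, φ (X i)
    exact Finset.measurable_sum _ fun i _ => hφ.comp (measurable_pi_apply i)
  have hFm : Measurable (Ftest φ Θ.ψ) := hlin.mul hΘm
  have hgm : ∀ i, Measurable (gtest φ i) := fun i => by
    show Measurable fun X : Config N => ∑ j ∈ univ.erase i, φ (X j)
    exact Finset.measurable_sum _ fun j _ => hφ.comp (measurable_pi_apply j)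
  have hbd : ∃ M' : ℝ, ∀ X, ‖Ftest φ Θ.ψ X‖ ≤ M' ∧ ∀ i, ‖gtest φ i X‖ ≤ M' := by
    refine ⟨N * |B| * (|M| + 1), fun X => ⟨?_, fun i => ?_⟩⟩
    · calc ‖Ftest φ Θ.ψ X‖ = ‖linStat φ X‖ * ‖Θ.ψ X‖ := norm_mul _ _
        _ ≤ (N * |B|) * |M| :=
            mul_le_mul (norm_sum_apply_le hB _ X) ((hM X).trans (le_abs_self M))
              (norm_nonneg _) (by positivity)
        _ ≤ N * |B| * (|M| + 1) := by
            gcongr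
            exact le_add_of_nonneg_right zero_le_one
    · calc ‖gtest φ i X‖ ≤ N * |B| := norm_sum_apply_le hB _ X
        _ ≤ N * |B| * (|M| + 1) :=
            le_mul_of_one_le_right (by positivity) (by linarith [abs_nonneg M])
  have hupd : ∀ (i : Fin N) (X : Config N) (x : Space),
      gtest φ i (Function.update X i x) = gtest φ i X :=
    fun i X x => gtest_update φ i X x
  obtain ⟨c, hc⟩ := hAT (Ftest φ Θ.ψ) (gtest φ) hFm hgm hbd hupd
  refine ⟨c, ?_⟩
  have e1 : (∫⁻ X in boxN N (sideLength ρ (N + 1)),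
        (‖(linStat φ X - c) * Θ.ψ X‖₊ : ℝ≥0∞) ^ 2)
      = ∫⁻ X in boxN N (sideLength ρ (N + 1)),
        (‖Ftest φ Θ.ψ X - c * Θ.ψ X‖₊ : ℝ≥0∞) ^ 2 := by
    refine lintegral_congr fun X => ?_
    simp only [Ftest, sub_mul]
  have e2 : ∀ i : Fin N, (∫⁻ X in boxN N (sideLength ρ (N + 1)),
        (‖φ (X i) * Θ.ψ X‖₊ : ℝ≥0∞) ^ 2)
      = ∫⁻ X in boxN N (sideLength ρ (N + 1)),
        (‖Ftest φ Θ.ψ X - gtest φ i X * Θ.ψ X‖₊ : ℝ≥0∞) ^ 2 := fun i => by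
    refine lintegral_congr fun X => ?_
    rw [Ftest_sub_gtest]
  rw [e1, Finset.sum_congr rfl fun i _ => e2 i]
  exact hc

/-- The counting statistic is the linear statistic of an indicator; indicators are bounded
measurable test functions, so the linear-statistic bound specialises to counts. [folklore] -/
theorem uniformSubPoissonianCounts_of_uniformLinearStatisticBound
    (h : UniformLinearStatisticBound) : UniformSubPoissonianCounts := by
  intro v hv
  obtain ⟨ρ₀, hρ₀, C, hC, H⟩ := h v hv
  refine ⟨ρ₀, hρ₀, C, hC, fun ρ hρ hρlt => ?_⟩
  filter_upwards [H ρ hρ hρlt] with N hN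
  intro δ hδ
  obtain ⟨Θ, hΘE, hlin⟩ := hN δ hδ
  refine ⟨Θ, hΘE, fun A hA => ?_⟩
  refine hlin (A.indicator fun _ => (1 : ℂ)) (measurable_const.indicator hA) ⟨1, fun x => ?_⟩
  by_cases hx : x ∈ A
  · simp [hx]
  · simp [hx]

/-- **The crux forces uniform sub-Poissonian number fluctuations.** [folklore] -/
theorem uniformSubPoissonianCounts_of_particleTensorisation
    (h : Summit.AtomisticToContinuum.BoseEinsteinCondensation.Theses.BECHeatBathGap.ParticleTensorisation) :
    UniformSubPoissonianCounts :=
  uniformSubPoissonianCounts_of_uniformLinearStatisticBound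
    (uniformLinearStatisticBound_of_particleTensorisation h)

end Summit.AtomisticToContinuum.BoseEinsteinCondensation.Cruxes.ParticleTensorisation.CensusR1
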